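import Summits.FinalStateConjecture.FinalStateConjecture.Statement
import Literature.Geometry.Lorentzian.CauchyDevelopment
import Literature.Geometry.Lorentzian.NullInfinity
import Literature.Geometry.Lorentzian.Isometry
import Literature.Geometry.Lorentzian.LeviCivitaProofs
import Literature.Geometry.Lorentzian.ConvergenceTransport
import HarnessLib

/-!
# Transport of complete future null infinity along an isometry of developments (registered stub
`stub_cni_transport`, line `Sketch` = tame template, crux `EIHFluxBalance.ModulatedKerrHandoff`,
item stmt-FinalStateConjecture-17402)

Let `𝒟₁`, `𝒟₂` be vacuum Cauchy developments of the same initial data set `D` on `X`, and let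
`ψ : M₁ ≃ M₂` be a time-orientation preserving isometric diffeomorphism with `ψ ∘ ι₁ = ι₂` (the
data of `CauchyDevelopment.IsIsometricTo`, i.e. of MGHD uniqueness up to isometry,
Choquet-Bruhat–Geroch 1969). GIVEN the ray correspondence (`γ` is a normalised future null ray of
`𝒟₁` from `p` on `dom` iff `ψ ∘ γ` is one of `𝒟₂`; a hypothesis here, landed separately as
`stub_rayTransport`), complete future null infinity in Christodoulou's sojourn form
(`Summit.FinalStateConjecture.HasCompleteNullInfinity`, `Statement.lean`; body
`LorentzianMetric.HasCompleteFutureNullInfinity`, `NullInfinity.lean`: a compact `B₀ ⊆ X` such that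
for every `s > 0`, outside a compact `B₁ ⊆ X`, every normalised future null ray from the data is
future complete or spends affine time `≥ s` in `J⁺(ι B₀)`) transports from `𝒟₁` to `𝒟₂` with the
SAME `B₀`, `B₁`: a ray `γ₂` of `𝒟₂` from `p ∉ B₁` is `ψ ∘ γ₁` with `γ₁ := ψ⁻¹ ∘ γ₂` a ray of
`𝒟₁` from `p` on the same affine domain; if `γ₁` is incomplete so is `γ₂` (same domain), and
otherwise the sojourn time of `γ₂` in `J⁺₂(ι₂ B₀)` dominates that of `γ₁` in `J⁺₁(ι₁ B₀)`,
because `ψ` carries `J⁺₁(ι₁ B₀)` into `J⁺₂(ψ (ι₁ B₀)) = J⁺₂(ι₂ B₀)`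
(`LorentzianMetric.image_causalFuture_subset`, `ConvergenceTransport.lean`: a time-orientation
preserving isometric immersion maps future causal curves to future causal curves, O'Neill 1983,
Ch. 14, pp. 402–403) and the Lebesgue measure is monotone. The Levi-Civita instance of `g₁` needed
to invoke the hypothesis on `𝒟₁` is the existence theorem `PseudoRiemannianMetric.hasLeviCivita`
(`LeviCivitaProofs.lean`; O'Neill 1983, Ch. 3, Thm. 3.11).
Mathlib + the Literature cone only; no definitions, no named facts.
O'Neill, *Semi-Riemannian geometry* (1983), Ch. 3, pp. 60–61, Ch. 14, pp. 402–403;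
Christodoulou, CQG 16 (1999) A23, pp. A26–A27.
Stub-worker of the line lead prover-line-stmt-FinalStateConjecture-17402-0, 2026-08-17.
-/

-- the summit-side namespace `Summit.FinalStateConjecture.FinalStateConjecture.…` (summit = problem)
-- repeats a component by design, which the `dupNamespace` linter would flag on every decl.
set_option linter.dupNamespace false

noncomputable section

open scoped Manifold ContDiff Topology ENNReal
open Set Function Literature.Geometry.Lorentzian

namespace Summit.FinalStateConjecture.FinalStateConjecture.Theorems.EIHFluxBalance.TameTemplate

/-- **Complete future null infinity transports along an isometry of developments** (registered
stub `stub_cni_transport` of line `Sketch`). For vacuum Cauchy developments `𝒟₁`, `𝒟₂` of `D`, a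
time-orientation preserving isometric diffeomorphism `ψ : M₁ ≃ M₂` with `ψ ∘ ι₁ = ι₂`, and the ray
correspondence (`ψ ∘ γ` is a normalised future null ray of `𝒟₂` from `p` iff `γ` is one of `𝒟₁`)
as a hypothesis: `HasCompleteNullInfinity 𝒟₁ → HasCompleteNullInfinity 𝒟₂`, with the same
compact sets `B₀`, `B₁`. A ray `γ₂` of `𝒟₂` is `ψ ∘ γ₁` with `γ₁ := ψ⁻¹ ∘ γ₂` a ray of `𝒟₁` on
the same domain, and `sojournTime γ₁ dom J⁺₁(ι₁ B₀) ≤ sojournTime (ψ ∘ γ₁) dom J⁺₂(ι₂ B₀)` since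
`ψ '' J⁺₁(ι₁ B₀) ⊆ J⁺₂(ψ '' ι₁ B₀) = J⁺₂(ι₂ B₀)` (`LorentzianMetric.image_causalFuture_subset`)
and the measure is monotone; the Levi-Civita instance of `g₁` is
`PseudoRiemannianMetric.hasLeviCivita`. [cite: ONeillSemiRiemannian1983, Ch. 14, pp. 402–403] -/
theorem stub_cni_transport : ∀ (X : Type) [TopologicalSpace X] [ChartedSpace E3 X] [IsManifold (𝓡 3) ((⊤ : ℕ∞) : WithTop ℕ∞) X] [T2Space X] [SecondCountableTopology X] [ConnectedSpace X] (D : InitialDataSet (𝓡 3) X) (𝒟₁ 𝒟₂ : VacuumCauchyDevelopment D) (ψ : Diffeomorph (𝓡 4) (𝓡 4) 𝒟₁.carrier 𝒟₂.carrier ((⊤ : ℕ∞) : WithTop ℕ∞)), 𝒟₁.metric.IsIsometry 𝒟₂.metric.toPseudoRiemannianMetric ψ → 𝒟₁.timeOrientation.PreservesTimeOrientation ψ 𝒟₂.timeOrientation → ψ ∘ 𝒟₁.embed = 𝒟₂.embed → (∀ [𝒟₁.metric.HasLeviCivita] [𝒟₂.metric.HasLeviCivita] (p : X) (γ : ℝ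 → 𝒟₁.carrier) (dom : Set ℝ), 𝒟₂.metric.IsNormalisedNullRayFrom 𝒟₂.timeOrientation 𝒟₂.embed 𝒟₂.normal p (ψ ∘ γ) dom ↔ 𝒟₁.metric.IsNormalisedNullRayFrom 𝒟₁.timeOrientation 𝒟₁.embed 𝒟₁.normal p γ dom) → Summit.FinalStateConjecture.HasCompleteNullInfinity 𝒟₁.toCauchyDevelopment → Summit.FinalStateConjecture.HasCompleteNullInfinity 𝒟₂.toCauchyDevelopment := by
  intro X _ _ _ _ _ _ D 𝒟₁ 𝒟₂ ψ hiso hτ hι hray h₁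
  unfold Summit.FinalStateConjecture.HasCompleteNullInfinity
  intro inst₂
  -- the Levi-Civita connection of the smooth metric `g₁` exists (O'Neill 1983, Thm. 3.11)
  haveI inst₁ : 𝒟₁.metric.HasLeviCivita := 𝒟₁.metric.toPseudoRiemannianMetric.hasLeviCivita
  obtain ⟨B₀, hB₀, hs⟩ := @h₁ inst₁
  refine ⟨B₀, hB₀, fun s hs0 ↦ ?_⟩
  obtain ⟨B₁, hB₁, hrays⟩ := hs s hs0
  refine ⟨B₁, hB₁, fun p hp γ₂ dom hγ₂ ↦ ?_⟩
  -- write the ray of `𝒟₂` as `γ₂ = ψ ∘ γ₁` with `γ₁ := ψ⁻¹ ∘ γ₂`, a ray of `𝒟₁` on the same domain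
  obtain ⟨γ₁, rfl⟩ : ∃ γ₁ : ℝ → 𝒟₁.carrier, (ψ : 𝒟₁.carrier → 𝒟₂.carrier) ∘ γ₁ = γ₂ :=
    ⟨(ψ.symm : 𝒟₂.carrier → 𝒟₁.carrier) ∘ γ₂, funext fun t ↦ ψ.apply_symm_apply (γ₂ t)⟩
  have hγ₁ : 𝒟₁.metric.IsNormalisedNullRayFrom 𝒟₁.timeOrientation 𝒟₁.embed 𝒟₁.normal p γ₁ dom :=
    (hray p γ₁ dom).1 hγ₂
  rcases hrays p hp γ₁ dom hγ₁ with hunb | hsoj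
  · exact Or.inl hunb
  · refine Or.inr (hsoj.trans ?_)
    -- `{t | γ₁ t ∈ J⁺₁(ι₁ B₀)} ⊆ {t | ψ (γ₁ t) ∈ J⁺₂(ι₂ B₀)}` as `ψ '' J⁺₁(S) ⊆ J⁺₂(ψ '' S)`
    unfold sojournTime
    refine MeasureTheory.measure_mono fun t ht ↦ ⟨ht.1, ht.2.1, ?_⟩
    have hψd : MDifferentiable (𝓡 4) (𝓡 4) ψ := ψ.contMDiff.mdifferentiable (by simp)
    have himg := LorentzianMetric.image_causalFuture_subset hψd hτ hiso (𝒟₁.embed '' B₀)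
      (mem_image_of_mem ψ ht.2.2)
    rw [← Set.image_comp, hι] at himg
    exact himg

end Summit.FinalStateConjecture.FinalStateConjecture.Theorems.EIHFluxBalance.TameTemplate

end
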